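import Summits.NavierStokesRegularity.NavierStokesRegularity.Theorems.PerpetualPumpAveragedTypeIBlowupPreviousPairRates

/-!
# Crux `PerpetualPump.AveragedTypeIBlowup` (stmt-NavierStokesRegularity-1835), line `Sketch`:
# stub `previousPair` — a priori estimates inside the bootstrap tube, II (decay of the spent bond)

Continuation of `…PreviousPairRates` (same section variables = standing hypotheses of the
stub `previousPair` + the bootstrap tube on `[0, s]`). With `R = b/q + 1 - bp ≥ 1/10` and
`|F| ≤ κω/4` the square bound `previousPair_sq_le` gives:

* `prevPair_wp_sq` — `wp² ≤ (5ω/2)² + wp(0)²` on `[0, s]` (hence `wp² ≤ q³B + 2`);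
* `prevPair_wp_front` — before `σI` (where `R ≥ B/25`): `wp² ≤ (25ω/(4B))² + e^{-κ∫R} wp(0)²`
  and the sign floor `wp ≥ -25ω/(4B)`;
* `prevPair_intR` — the decay budget `∫₀^{σI} R ≥ (B(1-e^{-σI}) - 3σI)/q ≥ 2Λ/3`;
* `prevPair_wp_σI` — `wp(σI)² ≤ ω²/100` (using `11√B e^{-κΛ/3} ≤ ω`; registered sub-goal
  `stub_prevPairDecay`);
* `prevPair_wp_weak` — `wp² ≤ 7ω²` on `[σI, s]`.

## References

T. Tao, *Finite time blowup for an averaged three-dimensional Navier–Stokes equation*, J. Amer.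
Math. Soc. 29 (2016), §5–6; folklore ODE calculus.
-/

noncomputable section

-- the summit namespace `…NavierStokesRegularity.NavierStokesRegularity…` is the tree convention
set_option linter.dupNamespace false
-- every lemma of this file lives inside one `variable … include` context (the bootstrap tube);
-- not every lemma uses every bundled hypothesis
set_option linter.unusedSectionVars false

open MeasureTheory Set Filter Topology

namespace Summit.NavierStokesRegularity.NavierStokesRegularity.Theorems.PerpetualPumpAveragedTypeIBlowup

section Tube

variable {bp wp b m0 m1 wl e0 e1 : ℝ → ℝ} {B Λ κ q θ η εb ω μ σI T s : ℝ}

variable (hκq : 4 / 5 ≤ κ ∧ κ ≤ 1 ∧ 1 ≤ q ∧ q ≤ 21 / 20)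
  (hsm : 0 ≤ η ∧ 0 < εb ∧ 10 * εb ≤ ω ∧ ω ≤ 1 / 100 ∧ 0 ≤ μ ∧
    η * (μ + 2 * Real.sqrt B) ≤ ω / 10 ∧ η * μ ≤ 1 / 20 ∧ 1 / 2 ≤ θ ∧ θ ≤ 1)
  (hBT : 1000 ≤ B ∧ 0 < σI ∧ σI ≤ 3 ∧ 0 < T ∧ T ≤ 10)
  (hΛ : 100 ≤ Λ ∧ Λ ≤ B * (1 - Real.exp (-σI)) ∧
    11 * Real.sqrt B * Real.exp (-(κ * Λ / 3)) ≤ ω)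
  (hcont : ContinuousOn bp (Icc 0 T) ∧ ContinuousOn wp (Icc 0 T) ∧ ContinuousOn b (Icc 0 T) ∧
    ContinuousOn m0 (Icc 0 T) ∧ ContinuousOn m1 (Icc 0 T) ∧ ContinuousOn wl (Icc 0 T) ∧
    ContinuousOn e0 (Icc 0 T) ∧ ContinuousOn e1 (Icc 0 T))
  (hode : (∀ σ ∈ Ioo 0 T, HasDerivAt bp
      (κ * (-(bp σ) - (wp σ) ^ 2 + (wl σ) ^ 2 - εb * bp σ * wp σ) + e0 σ) σ) ∧
    (∀ σ ∈ Ioo 0 T, HasDerivAt wp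
      (κ * (wp σ * (bp σ - b σ / q - 1) + εb * (bp σ) ^ 2) + e1 σ) σ))
  (herr : (∀ σ ∈ Icc 0 T, |e0 σ| ≤ η * κ * m0 σ) ∧ (∀ σ ∈ Icc 0 T, |e1 σ| ≤ η * κ * m1 σ) ∧
    (∀ σ ∈ Icc 0 T, 0 ≤ m0 σ ∧ m0 σ ≤ m0 0 * Real.exp (-(θ * κ * σ)) +
      κ * ∫ u in (0 : ℝ)..σ, Real.exp (-(θ * κ * (σ - u))) *
        |-(wp u) ^ 2 + (wl u) ^ 2 - εb * bp u * wp u|) ∧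
    (∀ σ ∈ Icc 0 T, 0 ≤ m1 σ ∧ m1 σ ≤ m1 0 * Real.exp (-(θ * κ * σ)) +
      κ * ∫ u in (0 : ℝ)..σ, Real.exp (-(θ * κ * (σ - u))) *
        |wp u * (bp u - b u / q) + εb * (bp u) ^ 2|))
  (henv : (∀ σ ∈ Icc 0 T, |wl σ| ≤ ω) ∧
    (∀ σ ∈ Icc 0 (min T σI), B * Real.exp (-σ) - 3 ≤ b σ) ∧
    (∀ σ ∈ Icc 0 T, -(1 / 2) ≤ b σ ∧ b σ ≤ B + 3))
  (hini : q ^ 4 / 2 - 3 / 20 ≤ bp 0 ∧ bp 0 ≤ q ^ 4 / 2 + 1 / 10 ∧ 0 ≤ wp 0 ∧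
    q ^ 3 * B - 1 ≤ (wp 0) ^ 2 ∧ (wp 0) ^ 2 ≤ q ^ 3 * B + 1 ∧ m0 0 ≤ μ ∧ m1 0 ≤ μ)
  (hs : s ∈ Icc 0 T)
  (hT : ∀ σ ∈ Icc 0 s, -(1 / 2) ≤ bp σ ∧ bp σ ≤ 9 / 10 ∧ (σ ≤ σI ∨ bp σ ≤ 2 / 5) ∧
    m1 σ ≤ μ + 3 * Real.sqrt B ∧ κ * ∫ u in (0 : ℝ)..σ, (wp u) ^ 2 ≤ 1)

include hκq hsm hBT hΛ hcont hode herr henv hini hs hT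

/-- **Crude decay of `wp²`.** `wp(σ)² ≤ (5ω/2)² + wp(0)²` on `[0, s]` (rate `R ≥ 1/10`,
forcing `|F| ≤ κω/4 = (5ω/2) κ/10`). [folklore] -/
theorem prevPair_wp_sq {σ : ℝ} (hσ : σ ∈ Icc 0 s) :
    wp σ ^ 2 ≤ (5 * ω / 2) ^ 2 + wp 0 ^ 2 := by
  obtain ⟨hRc, -, hwpc, -⟩ := prevPair_cont hκq hsm hBT hΛ hcont hode herr henv hini hs hT
  have hoder := fun (t : ℝ) (ht : t ∈ Ioo 0 s) =>
    prevPair_wp_ode hκq hsm hBT hΛ hcont hode herr henv hini hs hT ht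
  have hrate := fun (t : ℝ) (ht : t ∈ Icc 0 s) =>
    prevPair_rate hκq hsm hBT hΛ hcont hode herr henv hini hs hT ht
  have hFle := fun (t : ℝ) (ht : t ∈ Icc 0 s) =>
    prevPair_F_le hκq hsm hBT hΛ hcont hode herr henv hini hs hT ht
  obtain ⟨hκ0, -, -, -⟩ := hκq
  obtain ⟨-, hεb, hεω, -, -, -, -, -, -⟩ := hsm
  have hκ : 0 < κ := by linarith
  have hω0 : 0 ≤ ω := by linarith
  have hRpos : ∀ t ∈ Icc 0 s, 0 < b t / q + 1 - bp t := fun t ht => by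
    linarith only [(hrate t ht).1]
  have hFR : ∀ t ∈ Icc 0 s, |κ * εb * bp t ^ 2 + e1 t| ≤
      5 * ω / 2 * (κ * (b t / q + 1 - bp t)) := fun t ht => by
    have h1 := hFle t ht
    have h3 : 0 ≤ κ * ω * (b t / q + 1 - bp t - 1 / 10) :=
      mul_nonneg (mul_nonneg hκ.le hω0) (by linarith only [(hrate t ht).1])
    nlinarith only [h1, h3]
  have h := previousPair_sq_le (x := wp) (R := fun u => b u / q + 1 - bp u)
    (F := fun u => κ * εb * bp u ^ 2 + e1 u) hs.1 hκ hwpc hRc hoder hRpos hFR hσ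
  have hI : 0 ≤ ∫ u in (0:ℝ)..σ, (b u / q + 1 - bp u) :=
    intervalIntegral.integral_nonneg hσ.1 fun u hu => (hRpos u ⟨hu.1, hu.2.trans hσ.2⟩).le
  have hE : Real.exp (-(κ * ∫ u in (0:ℝ)..σ, (b u / q + 1 - bp u))) ≤ 1 :=
    Real.exp_le_one_iff.2 (by nlinarith only [hI, hκ])
  nlinarith only [h, hE, sq_nonneg (wp 0),
    Real.exp_pos (-(κ * ∫ u in (0:ℝ)..σ, (b u / q + 1 - bp u)))]

/-- **Decay of `wp` while the front is known (`σ ≤ σI`).** With `c = 25ω/(4B)` (`R ≥ B/25`):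
`wp(σ)² ≤ c² + e^{-κ∫₀^σ R} wp(0)²` and `-c ≤ wp(σ)`. [folklore] -/
theorem prevPair_wp_front {σ : ℝ} (hσ : σ ∈ Icc 0 s) (hσI : σ ≤ σI) :
    wp σ ^ 2 ≤ (25 * ω / (4 * B)) ^ 2 +
        Real.exp (-(κ * ∫ u in (0:ℝ)..σ, (b u / q + 1 - bp u))) * wp 0 ^ 2 ∧
      -(25 * ω / (4 * B)) ≤ wp σ := by
  obtain ⟨hRc, -, hwpc, -⟩ := prevPair_cont hκq hsm hBT hΛ hcont hode herr henv hini hs hT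
  have hoder := fun (t : ℝ) (ht : t ∈ Ioo 0 s) =>
    prevPair_wp_ode hκq hsm hBT hΛ hcont hode herr henv hini hs hT ht
  have hrate := fun (t : ℝ) (ht : t ∈ Icc 0 s) =>
    prevPair_rate hκq hsm hBT hΛ hcont hode herr henv hini hs hT ht
  have hFle := fun (t : ℝ) (ht : t ∈ Icc 0 s) =>
    prevPair_F_le hκq hsm hBT hΛ hcont hode herr henv hini hs hT ht
  obtain ⟨hκ0, -, -, -⟩ := hκq
  obtain ⟨-, hεb, hεω, -, -, -, -, -, -⟩ := hsm
  obtain ⟨hB, -, -, -, -⟩ := hBT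
  have hκ : 0 < κ := by linarith
  have hω0 : 0 ≤ ω := by linarith
  have hB0 : 0 < B := by linarith
  -- work on `[0, s']`, `s' = min s σI`
  have hs' : (0:ℝ) ≤ min s σI := le_min hs.1 (hσ.1.trans hσI)
  have hsub : Icc 0 (min s σI) ⊆ Icc 0 s := Icc_subset_Icc_right (min_le_left _ _)
  have hσ' : σ ∈ Icc 0 (min s σI) := ⟨hσ.1, le_min hσ.2 hσI⟩
  have hRpos : ∀ t ∈ Icc 0 (min s σI), 0 < b t / q + 1 - bp t := fun t ht => by
    linarith only [(hrate t (hsub ht)).1]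
  have hc0 : 0 ≤ 25 * ω / (4 * B) := by positivity
  have hFR : ∀ t ∈ Icc 0 (min s σI), |κ * εb * bp t ^ 2 + e1 t| ≤
      25 * ω / (4 * B) * (κ * (b t / q + 1 - bp t)) := fun t ht => by
    have h1 := hFle t (hsub ht)
    have h2 := (hrate t (hsub ht)).2.2.1 (ht.2.trans (min_le_right _ _))
    have h3 : 25 * ω / (4 * B) * (κ * (B / 25)) ≤
        25 * ω / (4 * B) * (κ * (b t / q + 1 - bp t)) :=
      mul_le_mul_of_nonneg_left (mul_le_mul_of_nonneg_left (by linarith only [h2]) hκ.le) hc0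
    have h4 : 25 * ω / (4 * B) * (κ * (B / 25)) = κ * ω / 4 := by
      field_simp
    linarith only [h1, h3, h4]
  have hoder' : ∀ t ∈ Ioo 0 (min s σI), HasDerivAt wp
      (-(κ * (b t / q + 1 - bp t) * wp t) + (κ * εb * bp t ^ 2 + e1 t)) t :=
    fun t ht => hoder t ⟨ht.1, ht.2.trans_le (min_le_left _ _)⟩
  refine ⟨previousPair_sq_le (x := wp) (R := fun u => b u / q + 1 - bp u)
      (F := fun u => κ * εb * bp u ^ 2 + e1 u) hs' hκ (hwpc.mono hsub) (hRc.mono hsub)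
      hoder' hRpos hFR hσ',
    previousPair_neg_le (x := wp) (R := fun u => b u / q + 1 - bp u)
      (F := fun u => κ * εb * bp u ^ 2 + e1 u) hs' (hwpc.mono hsub) (hRc.mono hsub)
      hoder' hFR (by linarith only [hc0, hini.2.2.1]) hσ'⟩

/-- **The decay budget before `σI`.** `∫₀^{σI} R ≥ (B(1 - e^{-σI}) - 3σI)/q ≥ (Λ - 9)/q ≥ 2Λ/3`.
[folklore] -/
theorem prevPair_intR (hσI : σI ≤ s) :
    2 * Λ / 3 ≤ ∫ u in (0:ℝ)..σI, (b u / q + 1 - bp u) := by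
  obtain ⟨hRc, -, -, -⟩ := prevPair_cont hκq hsm hBT hΛ hcont hode herr henv hini hs hT
  obtain ⟨-, -, hq1, hq2⟩ := hκq
  obtain ⟨-, hσI0, hσI3, -, -⟩ := hBT
  obtain ⟨hΛ1, hΛ2, -⟩ := hΛ
  obtain ⟨-, hfront, -⟩ := henv
  have hq0 : 0 < q := by linarith
  -- pointwise lower bound
  have hpt : ∀ u ∈ Icc 0 σI, (B * Real.exp (-u) - 3) / q ≤ b u / q + 1 - bp u := by
    intro u hu
    have huS : u ∈ Icc 0 s := ⟨hu.1, hu.2.trans hσI⟩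
    have hb := hfront u ⟨hu.1, le_min (huS.2.trans hs.2) hu.2⟩
    obtain ⟨-, hbp2, -, -, -⟩ := hT u huS
    have : (B * Real.exp (-u) - 3) / q ≤ b u / q := div_le_div_of_nonneg_right hb hq0.le
    linarith only [this, hbp2]
  -- the explicit integral
  have hderiv : ∀ u ∈ uIcc 0 σI, HasDerivAt (fun u => (-B * Real.exp (-u) - 3 * u) / q)
      ((B * Real.exp (-u) - 3) / q) u := by
    intro u _
    exact (((((hasDerivAt_neg u).exp).const_mul (-B)).sub
      ((hasDerivAt_id u).const_mul 3)).div_const q).congr_deriv (by ring)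
  have hcontφ : Continuous fun u => (B * Real.exp (-u) - 3) / q := by fun_prop
  have hval := intervalIntegral.integral_eq_sub_of_hasDerivAt hderiv
    (hcontφ.intervalIntegrable 0 σI)
  have hmono : ∫ u in (0:ℝ)..σI, (B * Real.exp (-u) - 3) / q ≤
      ∫ u in (0:ℝ)..σI, (b u / q + 1 - bp u) :=
    intervalIntegral.integral_mono_on hσI0.le (hcontφ.intervalIntegrable 0 σI)
      ((hRc.mono (Icc_subset_Icc_right hσI)).intervalIntegrable_of_Icc hσI0.le) hpt
  rw [hval] at hmono
  simp only [neg_zero, Real.exp_zero, mul_one, mul_zero, sub_zero] at hmono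
  -- `(B(1 - e^{-σI}) - 3σI)/q ≥ (Λ - 9)/q ≥ 2Λ/3`
  have h1 : Λ - 9 ≤ B * (1 - Real.exp (-σI)) - 3 * σI := by linarith only [hΛ2, hσI3]
  have h2 : (Λ - 9) / q ≤ (-B * Real.exp (-σI) - 3 * σI) / q - -B / q := by
    rw [← sub_div]; exact div_le_div_of_nonneg_right (by linarith only [h1]) hq0.le
  have h3 : 2 * Λ / 3 ≤ (Λ - 9) / q := by
    rw [le_div_iff₀ hq0]; nlinarith only [hΛ1, hq1, hq2]
  linarith only [hmono, h2, h3]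

/-- **The spent bond at `σI`.** `wp(σI)² ≤ ω²/100` (decay `e^{-2κΛ/3} ≤ (ω/(11√B))²` of the
homogeneous part, plus the forced part `(25ω/(4B))²`). [folklore] -/
theorem prevPair_wp_σI (hσI : σI ≤ s) : wp σI ^ 2 ≤ ω ^ 2 / 100 := by
  have hσI0 := hBT.2.1
  have hfr := prevPair_wp_front hκq hsm hBT hΛ hcont hode herr henv hini hs hT
    ⟨hσI0.le, hσI⟩ le_rfl
  have hint := prevPair_intR hκq hsm hBT hΛ hcont hode herr henv hini hs hT hσI
  obtain ⟨hκ0, -, hq1, hq2⟩ := hκq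
  obtain ⟨-, hεb, hεω, hω, -, -, -, -, -⟩ := hsm
  obtain ⟨hB, -, -, -, -⟩ := hBT
  obtain ⟨hΛ1, -, hdec⟩ := hΛ
  obtain ⟨-, -, -, -, hwp0sq, -, -⟩ := hini
  have hκ : 0 < κ := by linarith
  have hB0 : 0 < B := by linarith
  have hsB : 0 < Real.sqrt B := Real.sqrt_pos.2 hB0
  -- the homogeneous factor
  have hE : Real.exp (-(κ * ∫ u in (0:ℝ)..σI, (b u / q + 1 - bp u))) ≤
      Real.exp (-(κ * Λ / 3)) ^ 2 := by
    rw [← Real.exp_nat_mul, Real.exp_le_exp]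
    push_cast
    nlinarith only [hint, hκ]
  have hdec' : Real.exp (-(κ * Λ / 3)) ≤ ω / (11 * Real.sqrt B) := by
    rw [le_div_iff₀ (by positivity)]; linarith only [hdec]
  have hE2 : Real.exp (-(κ * Λ / 3)) ^ 2 ≤ (ω / (11 * Real.sqrt B)) ^ 2 :=
    pow_le_pow_left₀ (Real.exp_pos _).le hdec' 2
  have hE3 : (ω / (11 * Real.sqrt B)) ^ 2 = ω ^ 2 / (121 * B) := by
    rw [div_pow, mul_pow, Real.sq_sqrt hB0.le]; norm_num
  have hq3 : q ^ 3 ≤ 1158 / 1000 := by nlinarith [pow_le_pow_left₀ (by linarith) hq2 3]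
  have hwp0 : wp 0 ^ 2 ≤ 29 / 25 * B := by nlinarith only [hwp0sq, hq3, hB]
  have hhom : Real.exp (-(κ * ∫ u in (0:ℝ)..σI, (b u / q + 1 - bp u))) * wp 0 ^ 2 ≤
      ω ^ 2 / (121 * B) * (29 / 25 * B) := by
    have := (hE.trans hE2).trans_eq hE3
    exact mul_le_mul this hwp0 (sq_nonneg _) (by positivity)
  have hhom' : ω ^ 2 / (121 * B) * (29 / 25 * B) = 29 / 3025 * ω ^ 2 := by
    field_simp; ring
  -- the forced part
  have hc : (25 * ω / (4 * B)) ^ 2 ≤ ω ^ 2 / 25600 := by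
    rw [div_pow, mul_pow, mul_pow, div_le_div_iff₀ (by positivity) (by norm_num)]
    have hBB : 1000000 ≤ B ^ 2 := by nlinarith only [hB]
    nlinarith only [mul_le_mul_of_nonneg_left hBB (sq_nonneg ω)]
  nlinarith only [hfr.1, hhom, hhom', hc, sq_nonneg ω]

/-- **Crude bound after `σI`.** `wp(σ)² ≤ 7ω²` on `[σI, s]` (restart of `previousPair_sq_le`
at `σI`). [folklore] -/
theorem prevPair_wp_weak {σ : ℝ} (hσ : σ ∈ Icc σI s) : wp σ ^ 2 ≤ 7 * ω ^ 2 := by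
  have hσI0 := hBT.2.1
  have hσIs : σI ≤ s := hσ.1.trans hσ.2
  have hV := prevPair_wp_σI hκq hsm hBT hΛ hcont hode herr henv hini hs hT hσIs
  obtain ⟨hRc, -, hwpc, -⟩ := prevPair_cont hκq hsm hBT hΛ hcont hode herr henv hini hs hT
  have hoder := fun (t : ℝ) (ht : t ∈ Ioo 0 s) =>
    prevPair_wp_ode hκq hsm hBT hΛ hcont hode herr henv hini hs hT ht
  have hrate := fun (t : ℝ) (ht : t ∈ Icc 0 s) =>
    prevPair_rate hκq hsm hBT hΛ hcont hode herr henv hini hs hT ht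
  have hFle := fun (t : ℝ) (ht : t ∈ Icc 0 s) =>
    prevPair_F_le hκq hsm hBT hΛ hcont hode herr henv hini hs hT ht
  obtain ⟨hκ0, -, -, -⟩ := hκq
  obtain ⟨-, hεb, hεω, -, -, -, -, -, -⟩ := hsm
  have hκ : 0 < κ := by linarith
  have hω0 : 0 ≤ ω := by linarith
  have hsub : Icc σI s ⊆ Icc 0 s := Icc_subset_Icc_left hσI0.le
  have hRpos : ∀ t ∈ Icc σI s, 0 < b t / q + 1 - bp t := fun t ht => by
    linarith only [(hrate t (hsub ht)).1]
  have hFR : ∀ t ∈ Icc σI s, |κ * εb * bp t ^ 2 + e1 t| ≤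
      5 * ω / 2 * (κ * (b t / q + 1 - bp t)) := fun t ht => by
    have h1 := hFle t (hsub ht)
    have h3 : 0 ≤ κ * ω * (b t / q + 1 - bp t - 1 / 10) :=
      mul_nonneg (mul_nonneg hκ.le hω0) (by linarith only [(hrate t (hsub ht)).1])
    nlinarith only [h1, h3]
  have h := previousPair_sq_le (x := wp) (R := fun u => b u / q + 1 - bp u)
    (F := fun u => κ * εb * bp u ^ 2 + e1 u) hσIs hκ (hwpc.mono hsub) (hRc.mono hsub)
    (fun t ht => hoder t ⟨hσI0.trans ht.1, ht.2⟩) hRpos hFR hσ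
  have hI : 0 ≤ ∫ u in σI..σ, (b u / q + 1 - bp u) :=
    intervalIntegral.integral_nonneg hσ.1 fun u hu => (hRpos u ⟨hu.1, hu.2.trans hσ.2⟩).le
  have hE : Real.exp (-(κ * ∫ u in σI..σ, (b u / q + 1 - bp u))) ≤ 1 :=
    Real.exp_le_one_iff.2 (by nlinarith only [hI, hκ])
  nlinarith only [h, hE, hV, sq_nonneg (wp σI), sq_nonneg ω,
    Real.exp_pos (-(κ * ∫ u in σI..σ, (b u / q + 1 - bp u)))]

end Tube

/-- **Registered sub-goal `stub_prevPairDecay`** (stub `previousPair`, line `Sketch`):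
inside the bootstrap tube, the spent bond has decayed to `wp(σI)² ≤ ω²/100` at `σI`. [folklore] -/
theorem stub_prevPairDecay :
    ∀ (bp wp b m0 m1 wl e0 e1 : ℝ → ℝ) (B Λ κ q θ η εb ω μ σI T s : ℝ),
      (4 / 5 ≤ κ ∧ κ ≤ 1 ∧ 1 ≤ q ∧ q ≤ 21 / 20) →
      (0 ≤ η ∧ 0 < εb ∧ 10 * εb ≤ ω ∧ ω ≤ 1 / 100 ∧ 0 ≤ μ ∧
        η * (μ + 2 * Real.sqrt B) ≤ ω / 10 ∧ η * μ ≤ 1 / 20 ∧ 1 / 2 ≤ θ ∧ θ ≤ 1) →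
      (1000 ≤ B ∧ 0 < σI ∧ σI ≤ 3 ∧ 0 < T ∧ T ≤ 10) →
      (100 ≤ Λ ∧ Λ ≤ B * (1 - Real.exp (-σI)) ∧
        11 * Real.sqrt B * Real.exp (-(κ * Λ / 3)) ≤ ω) →
      (ContinuousOn bp (Icc 0 T) ∧ ContinuousOn wp (Icc 0 T) ∧ ContinuousOn b (Icc 0 T) ∧
        ContinuousOn m0 (Icc 0 T) ∧ ContinuousOn m1 (Icc 0 T) ∧ ContinuousOn wl (Icc 0 T) ∧
        ContinuousOn e0 (Icc 0 T) ∧ ContinuousOn e1 (Icc 0 T)) →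
      ((∀ σ ∈ Ioo 0 T, HasDerivAt bp
          (κ * (-(bp σ) - (wp σ) ^ 2 + (wl σ) ^ 2 - εb * bp σ * wp σ) + e0 σ) σ) ∧
        (∀ σ ∈ Ioo 0 T, HasDerivAt wp
          (κ * (wp σ * (bp σ - b σ / q - 1) + εb * (bp σ) ^ 2) + e1 σ) σ)) →
      ((∀ σ ∈ Icc 0 T, |e0 σ| ≤ η * κ * m0 σ) ∧ (∀ σ ∈ Icc 0 T, |e1 σ| ≤ η * κ * m1 σ) ∧
        (∀ σ ∈ Icc 0 T, 0 ≤ m0 σ ∧ m0 σ ≤ m0 0 * Real.exp (-(θ * κ * σ)) +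
          κ * ∫ u in (0 : ℝ)..σ, Real.exp (-(θ * κ * (σ - u))) *
            |-(wp u) ^ 2 + (wl u) ^ 2 - εb * bp u * wp u|) ∧
        (∀ σ ∈ Icc 0 T, 0 ≤ m1 σ ∧ m1 σ ≤ m1 0 * Real.exp (-(θ * κ * σ)) +
          κ * ∫ u in (0 : ℝ)..σ, Real.exp (-(θ * κ * (σ - u))) *
            |wp u * (bp u - b u / q) + εb * (bp u) ^ 2|)) →
      ((∀ σ ∈ Icc 0 T, |wl σ| ≤ ω) ∧
        (∀ σ ∈ Icc 0 (min T σI), B * Real.exp (-σ) - 3 ≤ b σ) ∧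
        (∀ σ ∈ Icc 0 T, -(1 / 2) ≤ b σ ∧ b σ ≤ B + 3)) →
      (q ^ 4 / 2 - 3 / 20 ≤ bp 0 ∧ bp 0 ≤ q ^ 4 / 2 + 1 / 10 ∧ 0 ≤ wp 0 ∧
        q ^ 3 * B - 1 ≤ (wp 0) ^ 2 ∧ (wp 0) ^ 2 ≤ q ^ 3 * B + 1 ∧ m0 0 ≤ μ ∧ m1 0 ≤ μ) →
      (s ∈ Icc 0 T) →
      (∀ σ ∈ Icc 0 s, -(1 / 2) ≤ bp σ ∧ bp σ ≤ 9 / 10 ∧ (σ ≤ σI ∨ bp σ ≤ 2 / 5) ∧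
        m1 σ ≤ μ + 3 * Real.sqrt B ∧ κ * ∫ u in (0 : ℝ)..σ, (wp u) ^ 2 ≤ 1) →
      σI ≤ s → wp σI ^ 2 ≤ ω ^ 2 / 100 :=
  fun _ _ _ _ _ _ _ _ _ _ _ _ _ _ _ _ _ _ _ _ hκq hsm hBT hΛ hcont hode herr henv hini hs hT hσI =>
    prevPair_wp_σI hκq hsm hBT hΛ hcont hode herr henv hini hs hT hσI

end Summit.NavierStokesRegularity.NavierStokesRegularity.Theorems.PerpetualPumpAveragedTypeIBlowup

end
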